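import Mathlib
import Summits.NavierStokesRegularity.NavierStokesRegularity.Theorems.EulerZoomLiouvillePowerGaugeEulerLiouvilleTransportShellLaw
import Summits.NavierStokesRegularity.NavierStokesRegularity.Theorems.EulerZoomLiouvillePowerGaugeEulerLiouvilleBallFirstMoments
import Summits.NavierStokesRegularity.NavierStokesRegularity.Theorems.EulerZoomLiouvillePowerGaugeEulerLiouvilleTransportMoments

/-!
# R50 plates t53-SF / t53-BC: the SPHERE FLUX of the transport field, the BALL CAP IDENTITY and the LOW-BALL CAPS
# (nsreg-p2 ROUND-50 «THE WALL COMES FOR FREE» §4, `NsregP2.R50.SphereFluxW γ` / `BallCapIdentity γ` / `LowBallCap γ`, texts VERBATIM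
# from `r50/Sketch50.lean` 6c31f8f6e879902e with `selfSimilarTransport` / `modPressure` UNFOLDED; seat ns-ezl-w2 g6,
# `--supports stmt-NavierStokesRegularity-19832 --as helper`)

With `W = γ(y−c)+V`, `Π = P − ½γ(1−γ)‖y−c‖²`, `ℋ = selfSimilarBernoulli γ c V P = ½‖W‖² + Π`, about EVERY centre `x₀` (`z = y − x₀`):
* `sphereFluxW γ`: `sphereIntegral(W_n)(r) = 4πγr` (ns-ezl-w2 g5's `ballFirstMoments` `∫_{B_ρ}⟪W,z⟫ = (4π/5)γρ⁵` in polar coordinates,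
  differentiated in `ρ`) and the Jensen floor `4π(γr)² ≤ sphereIntegral(W_n²)(r)` (`∫(f − γr)² ≥ 0` on the sphere);
* `ballCapIdentity γ`: `r⁴·sphereIntegral(W_n²+Π)(r) + ∫_B‖z‖(‖W‖² − W_n²) = 4∫_B‖z‖ℋ + (2π/3)γ(5γ−1)r⁶` — HYPOTHESIS-FREE: the tent and
  sphere mean-value formulas for the pair `(W, Π̂_{x₀})` (Π̂-trick, `…TransportGradientTest` + ns-sfl-p1 g8's general lemmas) combined as
  `r⁴Ŝ = r·B̂`, then the shift `Π = Π̂ + ½γ(5γ−1)‖z‖²` (`∫_B‖z‖³ = 2πr⁶/3`, `sphereIntegral(‖z‖²) = 4πr²`);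
* `lowBallCap γ`: `ℋ ≤ h` on `B̄_r(x₀)` ⇒ `sphereIntegral(W_n²+Π)(r) ≤ 4π(h + γ(5γ−1)r²/6)` and `sphereIntegral(Π)(r) ≤ 4π(h − γ(1+γ)r²/6)`.

HONEST FRAMING: ROUND-50 instrument identities (class-free); nothing about the crux E (19832 OPEN) or NS regularity.
[cite: ChaeWolf2016, Lemma 2.1 (2.1) and Remark 2.3 (2.8)] [folklore]
-/

noncomputable section

set_option linter.dupNamespace false

open MeasureTheory Set Filter Topology Metric Function TopologicalSpace
open scoped ENNReal NNReal RealInnerProductSpace Topology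

namespace Summit.NavierStokesRegularity.NavierStokesRegularity.Theorems.PowerGaugeEulerLiouville

open Literature.Analysis Literature.Analysis.FunctionSpaces Literature.Analysis.FluidPDE

namespace ClassicalProfile

/-! ## Sphere helpers -/

section Helpers

variable {U : EuclideanSpace ℝ (Fin 3) → EuclideanSpace ℝ (Fin 3)} {Q : EuclideanSpace ℝ (Fin 3) → ℝ}

/-- `⟪w, z⟫²/‖z‖² ≤ ‖w‖²` (Cauchy–Schwarz; the left side is `0` at `z = 0`). [folklore] -/
private theorem inner_sq_div_norm_sq_le_cap (w z : EuclideanSpace ℝ (Fin 3)) : ⟪w, z⟫ ^ 2 / ‖z‖ ^ 2 ≤ ‖w‖ ^ 2 := by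
  by_cases hz : z = 0
  · simp [hz]
  · rw [div_le_iff₀ (by positivity)]
    have h := abs_real_inner_le_norm w z
    have h0 : 0 ≤ |⟪w, z⟫| := abs_nonneg _
    nlinarith [sq_abs ⟪w, z⟫, norm_nonneg w, norm_nonneg z, mul_nonneg (norm_nonneg w) (norm_nonneg z)]

/-- The normal flux density `r ↦ ∫_σ ⟪U(rα + x₀), α⟫ dσ(α)` is continuous (on all of `ℝ`). [folklore] -/
theorem continuous_radialFluxDensity (hU : Continuous U) (x₀ : EuclideanSpace ℝ (Fin 3)) :
    Continuous fun r : ℝ => ∫ α : sphere (0 : EuclideanSpace ℝ (Fin 3)) 1,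
      ⟪U (r • (α : EuclideanSpace ℝ (Fin 3)) + x₀), (α : EuclideanSpace ℝ (Fin 3))⟫
        ∂(volume : Measure (EuclideanSpace ℝ (Fin 3))).toSphere := by
  have hpt : Continuous fun q : ℝ × sphere (0 : EuclideanSpace ℝ (Fin 3)) 1 =>
      q.1 • (q.2 : EuclideanSpace ℝ (Fin 3)) + x₀ :=
    (continuous_fst.smul (continuous_subtype_val.comp continuous_snd)).add continuous_const
  have hF : Continuous (Function.uncurry fun (r : ℝ) (α : sphere (0 : EuclideanSpace ℝ (Fin 3)) 1) =>
      ⟪U (r • (α : EuclideanSpace ℝ (Fin 3)) + x₀), (α : EuclideanSpace ℝ (Fin 3))⟫) :=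
    (hU.comp hpt).inner (continuous_subtype_val.comp continuous_snd)
  have h := continuous_parametric_integral_of_continuous
    (μ := (volume : Measure (EuclideanSpace ℝ (Fin 3))).toSphere) hF isCompact_univ
  simp only [Measure.restrict_univ] at h
  exact h

/-- At radius `r > 0`: `sphereIntegral(z ↦ ⟪U(z+x₀), z⟫/‖z‖)(r) = ∫_σ ⟪U(rα+x₀), α⟫ dσ`. [folklore] -/
theorem sphereIntegral_normalFlux_eq (x₀ : EuclideanSpace ℝ (Fin 3)) {r : ℝ} (hr : 0 < r) :
    sphereIntegral volume (fun z : EuclideanSpace ℝ (Fin 3) => ⟪U (z + x₀), z⟫ / ‖z‖) r =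
      ∫ α : sphere (0 : EuclideanSpace ℝ (Fin 3)) 1,
        ⟪U (r • (α : EuclideanSpace ℝ (Fin 3)) + x₀), (α : EuclideanSpace ℝ (Fin 3))⟫
          ∂(volume : Measure (EuclideanSpace ℝ (Fin 3))).toSphere := by
  rw [sphereIntegral_def]
  refine integral_congr_ae (Eventually.of_forall fun α => ?_)
  dsimp only
  rw [norm_smul_sphere hr.le α, inner_smul_right]
  field_simp

/-- At radius `r > 0`: `sphereIntegral(z ↦ ⟪U(z+x₀), z⟫²/‖z‖²)(r) = ∫_σ ⟪U(rα+x₀), α⟫² dσ`. [folklore] -/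
theorem sphereIntegral_normalSq_eq' (x₀ : EuclideanSpace ℝ (Fin 3)) {r : ℝ} (hr : 0 < r) :
    sphereIntegral volume (fun z : EuclideanSpace ℝ (Fin 3) => ⟪U (z + x₀), z⟫ ^ 2 / ‖z‖ ^ 2) r =
      ∫ α : sphere (0 : EuclideanSpace ℝ (Fin 3)) 1,
        ⟪U (r • (α : EuclideanSpace ℝ (Fin 3)) + x₀), (α : EuclideanSpace ℝ (Fin 3))⟫ ^ 2
          ∂(volume : Measure (EuclideanSpace ℝ (Fin 3))).toSphere := by
  have h := sphereIntegral_normalSq_eq (V := U) (P := fun _ => (0 : ℝ)) x₀ hr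
  simpa using h

/-- Splitting `sphereIntegral(U_n² + Q)(r) = sphereIntegral(U_n²)(r) + sphereIntegral(Q)(r)` at `r > 0` (`U`, `Q` continuous). [folklore] -/
theorem sphereIntegral_normalSq_add_eq_add (hU : Continuous U) (hQ : Continuous Q) (x₀ : EuclideanSpace ℝ (Fin 3)) {r : ℝ}
    (hr : 0 < r) :
    sphereIntegral volume (fun z : EuclideanSpace ℝ (Fin 3) => ⟪U (z + x₀), z⟫ ^ 2 / ‖z‖ ^ 2 + Q (z + x₀)) r =
      sphereIntegral volume (fun z : EuclideanSpace ℝ (Fin 3) => ⟪U (z + x₀), z⟫ ^ 2 / ‖z‖ ^ 2) r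
        + sphereIntegral volume (fun z : EuclideanSpace ℝ (Fin 3) => Q (z + x₀)) r := by
  rw [sphereIntegral_normalSq_eq x₀ hr, sphereIntegral_normalSq_eq' x₀ hr, sphereIntegral_def]
  have hc0 : Continuous fun θ : sphere (0 : EuclideanSpace ℝ (Fin 3)) 1 => r • (θ : EuclideanSpace ℝ (Fin 3)) + x₀ := by fun_prop
  exact integral_add (integrable_sphere_of_continuous (((hU.comp hc0).inner continuous_subtype_val).pow 2))
    (integrable_sphere_of_continuous (hQ.comp hc0))

/-- The tent integrand `⟪U, z⟫²/‖z‖` is integrable on every ball (`U` continuous). [folklore] -/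
theorem integrableOn_ball_inner_sq_div_norm (hU : Continuous U) (x₀ : EuclideanSpace ℝ (Fin 3)) (ρ : ℝ) :
    IntegrableOn (fun y => ⟪U y, y - x₀⟫ ^ 2 / ‖y - x₀‖) (ball x₀ ρ) := by
  have hcn : Continuous fun y : EuclideanSpace ℝ (Fin 3) => ‖y - x₀‖ := continuous_norm.comp (continuous_sub_right x₀)
  have hc : Continuous fun y => ‖U y‖ ^ 2 * ‖y - x₀‖ := by fun_prop
  have hci : Continuous fun y : EuclideanSpace ℝ (Fin 3) => ⟪U y, y - x₀⟫ := hU.inner (continuous_id.sub continuous_const)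
  refine Integrable.mono' ((hc.continuousOn.integrableOn_compact (isCompact_closedBall x₀ ρ)).mono_set ball_subset_closedBall)
    (((hci.measurable.pow_const 2).div hcn.measurable).aestronglyMeasurable) (ae_of_all _ fun y => ?_)
  rw [Real.norm_eq_abs, abs_of_nonneg (div_nonneg (sq_nonneg _) (norm_nonneg _))]
  exact inner_sq_div_norm_le (U y) (y - x₀)

/-- A continuous function is integrable on every ball. [folklore] -/
theorem integrableOn_ball_of_continuous' {f : EuclideanSpace ℝ (Fin 3) → ℝ} (hf : Continuous f)
    (x₀ : EuclideanSpace ℝ (Fin 3)) (ρ : ℝ) : IntegrableOn f (ball x₀ ρ) :=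
  (hf.continuousOn.integrableOn_compact (isCompact_closedBall x₀ ρ)).mono_set ball_subset_closedBall

end Helpers

/-! ## The sphere flux of the transport field -/

/-- **EXACT SPHERE FLUX OF THE TRANSPORT FIELD** (`NsregP2.R50.SphereFluxW γ`, text verbatim with `selfSimilarTransport` unfolded):
about every centre and every radius `r > 0`, `sphereIntegral(z ↦ ⟪W(z+x₀), z⟫/‖z‖)(r) = 4πγr` (`div W = 3γ`, via the ball first
moment `∫_{B_ρ}⟪W, z⟫ = (4π/5)γρ⁵` differentiated in `ρ`) and, by Jensen, `4π(γr)² ≤ sphereIntegral(z ↦ ⟪W(z+x₀), z⟫²/‖z‖²)(r)`.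
[folklore] -/
theorem sphereFluxW (γ : ℝ) :
    ∀ (c : EuclideanSpace ℝ (Fin 3)) (V : EuclideanSpace ℝ (Fin 3) → EuclideanSpace ℝ (Fin 3)) (P : EuclideanSpace ℝ (Fin 3) → ℝ),
      IsSelfSimilarEulerProfile γ c V P →
      ∀ (x₀ : EuclideanSpace ℝ (Fin 3)) (r : ℝ), 0 < r →
        sphereIntegral volume (fun z : EuclideanSpace ℝ (Fin 3) => ⟪γ • (z + x₀ - c) + V (z + x₀), z⟫ / ‖z‖) r
            = 4 * Real.pi * γ * r
        ∧ 4 * Real.pi * (γ * r) ^ 2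
            ≤ sphereIntegral volume (fun z : EuclideanSpace ℝ (Fin 3) => ⟪γ • (z + x₀ - c) + V (z + x₀), z⟫ ^ 2 / ‖z‖ ^ 2) r := by
  intro c V P hprof x₀ r hr
  set W : EuclideanSpace ℝ (Fin 3) → EuclideanSpace ℝ (Fin 3) := fun y => γ • (y - c) + V y with hW
  have hV : Continuous V := hprof.contDiff_velocity.continuous
  have hWc : Continuous W := by simp only [hW]; fun_prop
  -- the continuous flux density `N₁`
  set N₁ : ℝ → ℝ := fun t => ∫ α : sphere (0 : EuclideanSpace ℝ (Fin 3)) 1,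
      ⟪W (t • (α : EuclideanSpace ℝ (Fin 3)) + x₀), (α : EuclideanSpace ℝ (Fin 3))⟫
        ∂(volume : Measure (EuclideanSpace ℝ (Fin 3))).toSphere with hN₁
  have hN₁c : Continuous N₁ := continuous_radialFluxDensity hWc x₀
  -- the ball first moment in polar coordinates: `∫₀^ρ t³ N₁ = (4π/5)γρ⁵`
  have hpolar : ∀ ρ : ℝ, 0 < ρ → ∫ t in (0 : ℝ)..ρ, t ^ 3 * N₁ t = 4 * Real.pi / 5 * γ * ρ ^ 5 := by
    intro ρ hρ
    have hBM := (ballFirstMoments γ c V P hprof x₀ ρ hρ).2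
    have hI : IntegrableOn (fun y => ⟪W y, y - x₀⟫) (ball x₀ ρ) :=
      integrableOn_ball_of_continuous' (hWc.inner (continuous_id.sub continuous_const)) x₀ ρ
    have hp := setIntegral_ball_eq_intervalIntegral_sphereIntegral hI hρ.le
    simp only [add_sub_cancel_right] at hp
    have hrad : ∀ t ∈ uIoc (0 : ℝ) ρ, t ^ 2 * sphereIntegral volume
        (fun z : EuclideanSpace ℝ (Fin 3) => ⟪W (z + x₀), z⟫) t = t ^ 3 * N₁ t := by
      intro t _
      rw [sphereIntegral_def, hN₁]
      dsimp only
      rw [← integral_const_mul, ← integral_const_mul]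
      refine integral_congr_ae (Eventually.of_forall fun α => ?_)
      dsimp only
      rw [real_inner_smul_right]
      ring
    rw [intervalIntegral.integral_congr_ae (ae_of_all _ hrad)] at hp
    rw [← hp]
    exact hBM
  -- differentiate at `r`
  have hΦ : HasDerivAt (fun ρ : ℝ => ∫ t in (0 : ℝ)..ρ, t ^ 3 * N₁ t) (r ^ 3 * N₁ r) r :=
    (((continuous_pow 3).mul hN₁c).integral_hasStrictDerivAt 0 r).hasDerivAt
  have hΨ : HasDerivAt (fun ρ : ℝ => 4 * Real.pi / 5 * γ * ρ ^ 5) (4 * Real.pi / 5 * γ * (5 * r ^ 4)) r := by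
    have h := (hasDerivAt_pow 5 r).const_mul (4 * Real.pi / 5 * γ)
    simpa using h
  have heq : (fun ρ : ℝ => ∫ t in (0 : ℝ)..ρ, t ^ 3 * N₁ t) =ᶠ[𝓝 r] fun ρ : ℝ => 4 * Real.pi / 5 * γ * ρ ^ 5 := by
    filter_upwards [Ioi_mem_nhds hr] with ρ hρ
    exact hpolar ρ hρ
  have huniq := hΦ.unique (hΨ.congr_of_eventuallyEq heq)
  have hflux : N₁ r = 4 * Real.pi * γ * r := by
    have hr3 : 0 < r ^ 3 := by positivity
    have : r ^ 3 * N₁ r = r ^ 3 * (4 * Real.pi * γ * r) := by rw [huniq]; ring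
    exact mul_left_cancel₀ hr3.ne' this
  refine ⟨?_, ?_⟩
  · show sphereIntegral volume (fun z : EuclideanSpace ℝ (Fin 3) => ⟪W (z + x₀), z⟫ / ‖z‖) r = 4 * Real.pi * γ * r
    rw [sphereIntegral_normalFlux_eq (U := W) x₀ hr]
    exact hflux
  -- Jensen: `∫ (f − γr)² ≥ 0`
  show 4 * Real.pi * (γ * r) ^ 2 ≤ sphereIntegral volume (fun z : EuclideanSpace ℝ (Fin 3) => ⟪W (z + x₀), z⟫ ^ 2 / ‖z‖ ^ 2) r
  rw [sphereIntegral_normalSq_eq' (U := W) x₀ hr]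
  have hc0 : Continuous fun θ : sphere (0 : EuclideanSpace ℝ (Fin 3)) 1 => r • (θ : EuclideanSpace ℝ (Fin 3)) + x₀ := by fun_prop
  have hfc : Continuous fun θ : sphere (0 : EuclideanSpace ℝ (Fin 3)) 1 =>
      ⟪W (r • (θ : EuclideanSpace ℝ (Fin 3)) + x₀), (θ : EuclideanSpace ℝ (Fin 3))⟫ := (hWc.comp hc0).inner continuous_subtype_val
  have hI1 : Integrable (fun θ : sphere (0 : EuclideanSpace ℝ (Fin 3)) 1 =>
      ⟪W (r • (θ : EuclideanSpace ℝ (Fin 3)) + x₀), (θ : EuclideanSpace ℝ (Fin 3))⟫)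
      (volume : Measure (EuclideanSpace ℝ (Fin 3))).toSphere := integrable_sphere_of_continuous hfc
  have hI2 : Integrable (fun θ : sphere (0 : EuclideanSpace ℝ (Fin 3)) 1 =>
      ⟪W (r • (θ : EuclideanSpace ℝ (Fin 3)) + x₀), (θ : EuclideanSpace ℝ (Fin 3))⟫ ^ 2)
      (volume : Measure (EuclideanSpace ℝ (Fin 3))).toSphere := integrable_sphere_of_continuous (hfc.pow 2)
  have hI3 : Integrable (fun θ : sphere (0 : EuclideanSpace ℝ (Fin 3)) 1 =>
      ⟪W (r • (θ : EuclideanSpace ℝ (Fin 3)) + x₀), (θ : EuclideanSpace ℝ (Fin 3))⟫ ^ 2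
        - 2 * (γ * r) * ⟪W (r • (θ : EuclideanSpace ℝ (Fin 3)) + x₀), (θ : EuclideanSpace ℝ (Fin 3))⟫)
      (volume : Measure (EuclideanSpace ℝ (Fin 3))).toSphere := hI2.sub (hI1.const_mul _)
  have hIc : Integrable (fun _ : sphere (0 : EuclideanSpace ℝ (Fin 3)) 1 => (γ * r) ^ 2)
      (volume : Measure (EuclideanSpace ℝ (Fin 3))).toSphere := integrable_const _
  have hnn : 0 ≤ ∫ θ : sphere (0 : EuclideanSpace ℝ (Fin 3)) 1,
      (⟪W (r • (θ : EuclideanSpace ℝ (Fin 3)) + x₀), (θ : EuclideanSpace ℝ (Fin 3))⟫ - γ * r) ^ 2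
        ∂(volume : Measure (EuclideanSpace ℝ (Fin 3))).toSphere := integral_nonneg fun θ => sq_nonneg _
  have hexp : ∫ θ : sphere (0 : EuclideanSpace ℝ (Fin 3)) 1,
      (⟪W (r • (θ : EuclideanSpace ℝ (Fin 3)) + x₀), (θ : EuclideanSpace ℝ (Fin 3))⟫ - γ * r) ^ 2
        ∂(volume : Measure (EuclideanSpace ℝ (Fin 3))).toSphere
      = (∫ θ : sphere (0 : EuclideanSpace ℝ (Fin 3)) 1,
          ⟪W (r • (θ : EuclideanSpace ℝ (Fin 3)) + x₀), (θ : EuclideanSpace ℝ (Fin 3))⟫ ^ 2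
            ∂(volume : Measure (EuclideanSpace ℝ (Fin 3))).toSphere)
        - 2 * (γ * r) * N₁ r + 4 * Real.pi * (γ * r) ^ 2 := by
    have e : ∀ θ : sphere (0 : EuclideanSpace ℝ (Fin 3)) 1,
        (⟪W (r • (θ : EuclideanSpace ℝ (Fin 3)) + x₀), (θ : EuclideanSpace ℝ (Fin 3))⟫ - γ * r) ^ 2 =
        ⟪W (r • (θ : EuclideanSpace ℝ (Fin 3)) + x₀), (θ : EuclideanSpace ℝ (Fin 3))⟫ ^ 2
          - 2 * (γ * r) * ⟪W (r • (θ : EuclideanSpace ℝ (Fin 3)) + x₀), (θ : EuclideanSpace ℝ (Fin 3))⟫ + (γ * r) ^ 2 := by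
      intro θ; ring
    rw [integral_congr_ae (Eventually.of_forall e), integral_add hI3 hIc,
      integral_sub hI2 (hI1.const_mul _), integral_const_mul, integral_const, smul_eq_mul, Measure.toSphere_real_apply_univ,
      finrank_euclideanSpace_fin, measureReal_def, volume_real_ball_zero_one_fin_three]
    simp only [hN₁]
    push_cast
    ring
  rw [hexp, hflux] at hnn
  nlinarith [hnn]

/-! ## The ball cap identity and the low-ball caps -/

/-- **BALL CAP IDENTITY** (`NsregP2.R50.BallCapIdentity γ`, text verbatim with `selfSimilarTransport`/`modPressure` unfolded):
`r⁴·sphereIntegral(W_n² + Π)(r) + ∫_{B_r(x₀)} ‖z‖(‖W‖² − W_n²) = 4∫_{B_r(x₀)} ‖z‖·ℋ + (2π/3)γ(5γ−1)r⁶` — hypothesis-free.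
[cite: ChaeWolf2016, Lemma 2.1 (2.1)] [folklore] -/
theorem ballCapIdentity (γ : ℝ) :
    ∀ (c : EuclideanSpace ℝ (Fin 3)) (V : EuclideanSpace ℝ (Fin 3) → EuclideanSpace ℝ (Fin 3)) (P : EuclideanSpace ℝ (Fin 3) → ℝ),
      IsSelfSimilarEulerProfile γ c V P →
      ∀ (x₀ : EuclideanSpace ℝ (Fin 3)) (r : ℝ), 0 < r →
        r ^ 4 * sphereIntegral volume
              (fun z : EuclideanSpace ℝ (Fin 3) => ⟪γ • (z + x₀ - c) + V (z + x₀), z⟫ ^ 2 / ‖z‖ ^ 2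
                + (P (z + x₀) - γ * (1 - γ) / 2 * ‖z + x₀ - c‖ ^ 2)) r
          + (∫ y in ball x₀ r, ‖y - x₀‖ * (‖γ • (y - c) + V y‖ ^ 2
                - ⟪γ • (y - c) + V y, y - x₀⟫ ^ 2 / ‖y - x₀‖ ^ 2))
        = 4 * (∫ y in ball x₀ r, ‖y - x₀‖ * selfSimilarBernoulli γ c V P y)
          + 2 * Real.pi / 3 * γ * (5 * γ - 1) * r ^ 6 := by
  intro c V P hprof x₀ r hr
  set W : EuclideanSpace ℝ (Fin 3) → EuclideanSpace ℝ (Fin 3) := fun y => γ • (y - c) + V y with hW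
  set Pm : EuclideanSpace ℝ (Fin 3) → ℝ := fun y => P y - γ * (1 - γ) / 2 * ‖y - c‖ ^ 2 with hPm
  set Ph : EuclideanSpace ℝ (Fin 3) → ℝ := fun y =>
    P y - γ * (1 - γ) / 2 * ‖y - c‖ ^ 2 - γ * (5 * γ - 1) / 2 * ‖y - x₀‖ ^ 2 with hPh
  have hV : Continuous V := hprof.contDiff_velocity.continuous
  have hP : Continuous P := hprof.contDiff_pressure.continuous
  have hWc : Continuous W := by simp only [hW]; fun_prop
  have hPmc : Continuous Pm := by simp only [hPm]; fun_prop
  have hPhc : Continuous Ph := by simp only [hPh]; fun_prop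
  have hcn : Continuous fun y : EuclideanSpace ℝ (Fin 3) => ‖y - x₀‖ := continuous_norm.comp (continuous_sub_right x₀)
  -- tent and sphere mean-value formulas for `(W, Π̂)`, and the sphere shift
  have hMV : ∀ ρ : ℝ, 0 < ρ → ∫ y in ball x₀ ρ, (⟪W y, y - x₀⟫ ^ 2 / ‖y - x₀‖ + ‖y - x₀‖ * Ph y)
      = ∫ y in ball x₀ ρ, (ρ - ‖y - x₀‖) * (‖W y‖ ^ 2 + 3 * Ph y) := fun ρ hρ =>
    meanValueFormula_of_radialVirial hWc hPhc x₀
      (fun ψ h1 h2 => transportRadialVirialIdentity γ c V P hprof x₀ ψ h1 h2) hρ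
  have htent := hMV r hr
  have hsph := sphereMeanValueFormula_of_meanValue hWc hPhc x₀ hMV hr
  have hshift := sphereIntegral_normalSq_add_shift hWc hPmc x₀ (γ * (5 * γ - 1) / 2) hr
  -- the ball integrals
  have iT : IntegrableOn (fun y => ⟪W y, y - x₀⟫ ^ 2 / ‖y - x₀‖) (ball x₀ r) := integrableOn_ball_inner_sq_div_norm hWc x₀ r
  have iQ : IntegrableOn (fun y => ‖y - x₀‖ * Ph y) (ball x₀ r) := integrableOn_ball_of_continuous' (by fun_prop) x₀ r
  have iE : IntegrableOn (fun y => ‖y - x₀‖ * ‖W y‖ ^ 2) (ball x₀ r) := integrableOn_ball_of_continuous' (by fun_prop) x₀ r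
  have iB : IntegrableOn (fun y => r * (‖W y‖ ^ 2 + 3 * Ph y)) (ball x₀ r) := integrableOn_ball_of_continuous' (by fun_prop) x₀ r
  have iEQ : IntegrableOn (fun y => ‖y - x₀‖ * ‖W y‖ ^ 2 + 3 * (‖y - x₀‖ * Ph y)) (ball x₀ r) := iE.add (iQ.const_mul 3)
  have i3 : IntegrableOn (fun y => γ * (5 * γ - 1) / 2 * ‖y - x₀‖ ^ 3) (ball x₀ r) :=
    integrableOn_ball_of_continuous' (by fun_prop) x₀ r
  have iH : IntegrableOn (fun y => 1 / 2 * (‖y - x₀‖ * ‖W y‖ ^ 2) + ‖y - x₀‖ * Ph y) (ball x₀ r) := (iE.const_mul _).add iQ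
  have htent' : (∫ y in ball x₀ r, ⟪W y, y - x₀⟫ ^ 2 / ‖y - x₀‖) + (∫ y in ball x₀ r, ‖y - x₀‖ * Ph y)
      = r * (∫ y in ball x₀ r, (‖W y‖ ^ 2 + 3 * Ph y))
        - ((∫ y in ball x₀ r, ‖y - x₀‖ * ‖W y‖ ^ 2) + 3 * ∫ y in ball x₀ r, ‖y - x₀‖ * Ph y) := by
    rw [← integral_add iT iQ, htent, ← integral_const_mul, ← integral_const_mul, ← integral_add iE (iQ.const_mul 3),
      ← integral_sub iB iEQ]
    refine integral_congr_ae (ae_of_all _ fun y => ?_)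
    ring
  have hL2 : ∫ y in ball x₀ r, ‖y - x₀‖ * (‖W y‖ ^ 2 - ⟪W y, y - x₀⟫ ^ 2 / ‖y - x₀‖ ^ 2)
      = (∫ y in ball x₀ r, ‖y - x₀‖ * ‖W y‖ ^ 2) - ∫ y in ball x₀ r, ⟪W y, y - x₀⟫ ^ 2 / ‖y - x₀‖ := by
    rw [← integral_sub iE iT]
    refine integral_congr_ae (ae_of_all _ fun y => ?_)
    by_cases hy : ‖y - x₀‖ = 0
    · simp [hy]
    · field_simp
  have hR : ∫ y in ball x₀ r, ‖y - x₀‖ * selfSimilarBernoulli γ c V P y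
      = 1 / 2 * (∫ y in ball x₀ r, ‖y - x₀‖ * ‖W y‖ ^ 2) + (∫ y in ball x₀ r, ‖y - x₀‖ * Ph y)
        + γ * (5 * γ - 1) / 2 * ∫ y in ball x₀ r, ‖y - x₀‖ ^ 3 := by
    rw [← integral_const_mul, ← integral_const_mul, ← integral_add (iE.const_mul _) iQ, ← integral_add iH i3]
    refine integral_congr_ae (ae_of_all _ fun y => ?_)
    simp only [selfSimilarBernoulli_apply, hW, hPh]
    ring
  have hPhPm : (fun z : EuclideanSpace ℝ (Fin 3) => ⟪W (z + x₀), z⟫ ^ 2 / ‖z‖ ^ 2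
      + (Pm (z + x₀) - γ * (5 * γ - 1) / 2 * ‖z‖ ^ 2)) = fun z => ⟪W (z + x₀), z⟫ ^ 2 / ‖z‖ ^ 2 + Ph (z + x₀) := by
    funext z
    simp only [hPm, hPh, add_sub_cancel_right]
  rw [hPhPm] at hshift
  rw [hshift, hL2, hR, integral_ball_norm_sub_pow_three x₀ hr.le]
  linear_combination r * hsph - htent'

/-- **LOW-BALL CAPS** (`NsregP2.R50.LowBallCap γ`, text verbatim with `selfSimilarTransport`/`modPressure` unfolded): if `ℋ ≤ h` on the
closed ball `B̄_r(x₀)` then `sphereIntegral(W_n² + Π)(r) ≤ 4π(h + γ(5γ−1)r²/6)` and `sphereIntegral(Π)(r) ≤ 4π(h − γ(1+γ)r²/6)`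
(`ballCapIdentity`, `∫_{B_r}‖z‖ = πr⁴`, `‖W‖² ≥ W_n²`, and the Jensen floor of `sphereFluxW`). [folklore] -/
theorem lowBallCap (γ : ℝ) :
    ∀ (c : EuclideanSpace ℝ (Fin 3)) (V : EuclideanSpace ℝ (Fin 3) → EuclideanSpace ℝ (Fin 3)) (P : EuclideanSpace ℝ (Fin 3) → ℝ),
      IsSelfSimilarEulerProfile γ c V P →
      ∀ (x₀ : EuclideanSpace ℝ (Fin 3)) (r h : ℝ), 0 < r →
        (∀ y ∈ closedBall x₀ r, selfSimilarBernoulli γ c V P y ≤ h) →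
          sphereIntegral volume
              (fun z : EuclideanSpace ℝ (Fin 3) => ⟪γ • (z + x₀ - c) + V (z + x₀), z⟫ ^ 2 / ‖z‖ ^ 2
                + (P (z + x₀) - γ * (1 - γ) / 2 * ‖z + x₀ - c‖ ^ 2)) r
            ≤ 4 * Real.pi * (h + γ * (5 * γ - 1) / 6 * r ^ 2)
          ∧ sphereIntegral volume (fun z : EuclideanSpace ℝ (Fin 3) => P (z + x₀) - γ * (1 - γ) / 2 * ‖z + x₀ - c‖ ^ 2) r
            ≤ 4 * Real.pi * (h - γ * (1 + γ) / 6 * r ^ 2) := by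
  intro c V P hprof x₀ r h hr hH
  set W : EuclideanSpace ℝ (Fin 3) → EuclideanSpace ℝ (Fin 3) := fun y => γ • (y - c) + V y with hW
  set Pm : EuclideanSpace ℝ (Fin 3) → ℝ := fun y => P y - γ * (1 - γ) / 2 * ‖y - c‖ ^ 2 with hPm
  have hV : Continuous V := hprof.contDiff_velocity.continuous
  have hP : Continuous P := hprof.contDiff_pressure.continuous
  have hWc : Continuous W := by simp only [hW]; fun_prop
  have hPmc : Continuous Pm := by simp only [hPm]; fun_prop
  have hcap := ballCapIdentity γ c V P hprof x₀ r hr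
  -- the tangential term is nonnegative and `∫‖z‖ℋ ≤ h·πr⁴`
  have hT : 0 ≤ ∫ y in ball x₀ r, ‖y - x₀‖ * (‖W y‖ ^ 2 - ⟪W y, y - x₀⟫ ^ 2 / ‖y - x₀‖ ^ 2) :=
    setIntegral_nonneg measurableSet_ball fun y _ =>
      mul_nonneg (norm_nonneg _) (sub_nonneg.2 (inner_sq_div_norm_sq_le_cap (W y) (y - x₀)))
  have hHc : Continuous (selfSimilarBernoulli γ c V P) := by
    have : selfSimilarBernoulli γ c V P = fun y => (1 / 2 : ℝ) * ‖γ • (y - c) + V y‖ ^ 2 + P y + γ * (γ - 1) / 2 * ‖y - c‖ ^ 2 :=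
      funext fun y => selfSimilarBernoulli_apply γ c V P y
    rw [this]; fun_prop
  have hmono : ∫ y in ball x₀ r, ‖y - x₀‖ * selfSimilarBernoulli γ c V P y ≤ ∫ y in ball x₀ r, ‖y - x₀‖ * h := by
    refine setIntegral_mono_on (integrableOn_ball_of_continuous' (by fun_prop) x₀ r)
      (integrableOn_ball_of_continuous' (by fun_prop) x₀ r) measurableSet_ball fun y hy => ?_
    exact mul_le_mul_of_nonneg_left (hH y (ball_subset_closedBall hy)) (norm_nonneg _)
  rw [integral_mul_const, integral_ball_norm_sub_eq x₀ hr.le] at hmono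
  have h1 : sphereIntegral volume (fun z : EuclideanSpace ℝ (Fin 3) => ⟪W (z + x₀), z⟫ ^ 2 / ‖z‖ ^ 2 + Pm (z + x₀)) r
      ≤ 4 * Real.pi * (h + γ * (5 * γ - 1) / 6 * r ^ 2) := by
    have hr4 : 0 < r ^ 4 := by positivity
    refine le_of_mul_le_mul_left ?_ hr4
    nlinarith [hcap, hT, hmono, hr4]
  refine ⟨h1, ?_⟩
  have hsplit := sphereIntegral_normalSq_add_eq_add hWc hPmc x₀ hr
  have hflux := (sphereFluxW γ c V P hprof x₀ r hr).2
  rw [hsplit] at h1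
  nlinarith [h1, hflux]

end ClassicalProfile

end Summit.NavierStokesRegularity.NavierStokesRegularity.Theorems.PowerGaugeEulerLiouville

end
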